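import Summits.AtomisticToContinuum.HydrodynamicLimit.Theses.InformationPercolationEngine
import Summits.AtomisticToContinuum.HydrodynamicLimit.Theorems.InformationPercolationEngineChaosClosesEulerMassBalance
import Summits.AtomisticToContinuum.HydrodynamicLimit.Theorems.InformationPercolationEngineChaosClosesEulerCollisionInvariance
import Literature.Analysis.FluidPDE.HardSphereCollisionEnumeration
import Literature.Analysis.FluidPDE.HardSphereDynamicsProofs
import HarnessLib

/-!
# Bogolyubov's exact weak equation for the cone-mollified `ψ`-moments of one hard-sphere trajectory

Stub `stub_weakEquation` of line `Sketch` of the crux `InformationPercolationEngine.ChaosClosesEuler`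
(stmt-AtomisticToContinuum-15141). Along ONE good orbit `γ s = Φ.flow s z` of the hard-sphere flow on `𝕋³`, for the
`r`-cone-mollified `ψ`-moment field `M_ψ(w)(x₀) = ∫ b_r(q.1, x₀) ψ(q.2) dμ_w` (`μ_w` the empirical measure) and its
current `J_ψ(w)(x₀)_k = ∫ b_r(q.1, x₀) q.2_k ψ(q.2) dμ_w`, and every smooth space-time test function `φ`,
`∫φ(t)M_ψ(t) − ∫φ(0)M_ψ(0) = ∫₀ᵗ∫(∂ₛφ M_ψ + J_ψ·∇φ) + (N+1)⁻¹ Σ_{collisions s ∈ (0,t]} Σ_{contact pairs (i,j)}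
(∫φ(s)b_r(xᵢ(s), ·)) (ψ(vᵢ(s)) − ψ(vᵢ(s⁻)))`: free transport between collisions plus the jumps of the step
functions `s ↦ ψ(vᵢ(s))` (Bogolyubov 1975; Pulvirenti–Simonella, arXiv:1504.03215 §1). A DETERMINISTIC finite-`N`
identity; `ψ` needs no regularity (all velocity integrals are finite sums).

PROOF. The cone depends on the torus difference only, `b_r(y, x) = h(x − y)` with `h` continuous, so after
unfolding the empirical integrals the pairing is `(N+1)⁻¹ F(s)`, `F(s) = Σᵢ ψ(vᵢ(s)) ∫ φ(s, x) h(x − xᵢ(s)) dx`.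
On a stretch `[a, b]` with `(a, b)` collision-free, positions follow the free flight (endpoints included) and
velocities are frozen on `[a, b)` and in the left limit at `b`, so the fundamental theorem of calculus for the
free-flight pairing (`ChaosClosesEulerMassBalance.hasDerivAt_integral_freeFlight`) gives
`F⁻(b) − F(a) = ∫ₐᵇ Σᵢ ψ(vᵢ) Dᵢ` with `F⁻` reading the left-limit velocities (`ftc_free_left`). An abstract gluing
lemma (`glue_pieces`: induction on the number of jump times in `(a, b]`, splitting at the last one) turns this into
`F(b) − F(a) = ∫ₐᵇ … + Σ_{s ∈ C ∩ (a, b]} (F(s) − F⁻(s))`, and at a collision time the route's ordered-contact-pair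
sum is `F(s) − F⁻(s)` (`ChaosClosesEulerCollisionInvariance.pairSum_eq_particleSum`).

REFERENCES. N. N. Bogolyubov, Theor. Math. Phys. 24 (1975) 804–807; M. Pulvirenti, S. Simonella, *On the evolution
of the empirical measure for the hard-sphere dynamics*, arXiv:1504.03215, §1.
-/

noncomputable section

namespace Summit.AtomisticToContinuum.HydrodynamicLimit.Theorems.ChaosClosesEulerWeakEquation

open scoped BigOperators Topology Classical MeasureTheory ENNReal InnerProductSpace
open Filter Set MeasureTheory
open Literature.MathematicalPhysics.KineticTheory
open Literature.Analysis.FluidPDE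

/-! ## §1 Gluing free stretches across finitely many jump times -/

/-- **Gluing lemma (abstract).** Let `C ⊆ ℝ` be locally finite with a free open interval to the left of every
time, and let `F, F⁻, I : ℝ → ℝ` satisfy: on every `a < b` with `(a, b) ∩ C = ∅`, `I` is interval integrable and
`∫ₐᵇ I = F⁻(b) − F(a)`; and `F⁻ = F` off `C`. Then for `a ≤ b`,
`F(b) − F(a) = ∫ₐᵇ I + Σ_{s ∈ C ∩ (a, b]} (F(s) − F⁻(s))` (induction on `#(C ∩ (a, b])`, splitting at the last
jump time). [folklore] -/
theorem glue_pieces {C : Set ℝ} (F Fm I : ℝ → ℝ)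
    (hfin : ∀ a b, (C ∩ Set.Icc a b).Finite)
    (hleft : ∀ t, ∃ s < t, ∀ τ ∈ Set.Ioo s t, τ ∉ C)
    (hfree : ∀ ⦃a b : ℝ⦄, a < b → (∀ τ ∈ Set.Ioo a b, τ ∉ C) →
      IntervalIntegrable I volume a b ∧ ∫ s in a..b, I s = Fm b - F a)
    (hval : ∀ ⦃b : ℝ⦄, b ∉ C → Fm b = F b) :
    ∀ (m : ℕ) ⦃a b : ℝ⦄, a ≤ b → (C ∩ Set.Ioc a b).ncard ≤ m →
      IntervalIntegrable I volume a b ∧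
      F b - F a = (∫ s in a..b, I s) + ∑ᶠ s ∈ C ∩ Set.Ioc a b, (F s - Fm s) := by
  have hfin' : ∀ a b, (C ∩ Set.Ioc a b).Finite := fun a b =>
    (hfin a b).subset (Set.inter_subset_inter_right _ Set.Ioc_subset_Icc_self)
  -- a stretch `[a, b]` without jump time in `(a, b]`
  have hzero : ∀ ⦃a b : ℝ⦄, a ≤ b → (∀ τ ∈ Set.Ioc a b, τ ∉ C) →
      IntervalIntegrable I volume a b ∧ F b - F a = ∫ s in a..b, I s := by
    intro a b hab hno
    rcases eq_or_lt_of_le hab with rfl | hlt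
    · exact ⟨IntervalIntegrable.refl, by simp⟩
    · obtain ⟨hi, he⟩ := hfree hlt fun τ hτ => hno τ ⟨hτ.1, hτ.2.le⟩
      exact ⟨hi, by rw [he, hval (hno b ⟨hlt, le_rfl⟩)]⟩
  have hzero' : ∀ ⦃a b : ℝ⦄, a ≤ b → (∀ τ ∈ Set.Ioc a b, τ ∉ C) →
      IntervalIntegrable I volume a b ∧
      F b - F a = (∫ s in a..b, I s) + ∑ᶠ s ∈ C ∩ Set.Ioc a b, (F s - Fm s) := by
    intro a b hab hno
    rw [Set.eq_empty_of_forall_notMem (s := C ∩ Set.Ioc a b) fun s hs => hno s hs.2 hs.1, finsum_mem_empty,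
      add_zero]
    exact hzero hab hno
  intro m
  induction m with
  | zero =>
    intro a b hab hcard
    have hempty : C ∩ Set.Ioc a b = ∅ := (Set.ncard_eq_zero (hfin' a b)).1 (Nat.le_zero.1 hcard)
    refine hzero' hab fun τ hτ hτC => ?_
    have hmem : τ ∈ C ∩ Set.Ioc a b := ⟨hτC, hτ⟩
    rw [hempty] at hmem
    exact hmem
  | succ m ih =>
    intro a b hab hcard
    by_cases hne : (C ∩ Set.Ioc a b).Nonempty
    swap
    · exact hzero' hab fun τ hτ hτC => hne ⟨τ, hτC, hτ⟩
    -- the last jump time `τ ∈ (a, b]`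
    have hTne : (hfin' a b).toFinset.Nonempty := (hfin' a b).toFinset_nonempty.2 hne
    obtain ⟨τ, hτmem, hτmax⟩ : ∃ τ ∈ C ∩ Set.Ioc a b, ∀ s ∈ C ∩ Set.Ioc a b, s ≤ τ :=
      ⟨(hfin' a b).toFinset.max' hTne, (hfin' a b).mem_toFinset.1 (Finset.max'_mem _ _),
        fun s hs => Finset.le_max' _ s ((hfin' a b).mem_toFinset.2 hs)⟩
    have hafter : ∀ s ∈ Set.Ioc τ b, s ∉ C := fun s hs hsC =>
      (not_lt.2 (hτmax s ⟨hsC, hτmem.2.1.trans hs.1, hs.2⟩)) hs.1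
    -- a time `u ∈ [a, τ)` with `(u, τ)` free
    obtain ⟨s₀, hs₀, hs₀free⟩ := hleft τ
    obtain ⟨u, hau, huτ, hufree⟩ : ∃ u, a ≤ u ∧ u < τ ∧ ∀ s ∈ Set.Ioo u τ, s ∉ C :=
      ⟨max a ((s₀ + τ) / 2), le_max_left _ _, max_lt hτmem.2.1 (by linarith), fun s hs =>
        hs₀free s ⟨lt_of_lt_of_le (by linarith) ((le_max_right _ _).trans hs.1.le), hs.2⟩⟩
    -- the three pieces
    have hcard' : (C ∩ Set.Ioc a u).ncard ≤ m := by
      have hss : C ∩ Set.Ioc a u ⊂ C ∩ Set.Ioc a b :=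
        Set.ssubset_iff_subset_ne.2 ⟨Set.inter_subset_inter_right _
          (Set.Ioc_subset_Ioc_right (huτ.le.trans hτmem.2.2)), fun heq => by
            have hτu : τ ∈ C ∩ Set.Ioc a u := by rw [heq]; exact hτmem
            exact (not_le.2 huτ) hτu.2.2⟩
      have := Set.ncard_lt_ncard hss (hfin' a b)
      omega
    obtain ⟨hi1, he1⟩ := ih hau hcard'
    obtain ⟨hi2, he2⟩ := hfree huτ hufree
    obtain ⟨hi3, he3⟩ := hzero hτmem.2.2 hafter
    -- the jump set splits off its last element
    have hsplit : C ∩ Set.Ioc a b = (C ∩ Set.Ioc a u) ∪ {τ} := by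
      ext s
      constructor
      · intro hs
        by_cases hsu : s ≤ u
        · exact Or.inl ⟨hs.1, hs.2.1, hsu⟩
        · rcases lt_trichotomy s τ with h | h | h
          · exact absurd hs.1 (hufree s ⟨lt_of_not_ge hsu, h⟩)
          · exact Or.inr h
          · exact absurd hs.1 (hafter s ⟨h, hs.2.2⟩)
      · rintro (hs | hs)
        · exact ⟨hs.1, hs.2.1, hs.2.2.trans (huτ.le.trans hτmem.2.2)⟩
        · rw [Set.mem_singleton_iff.1 hs]
          exact hτmem
    have hdisj : Disjoint (C ∩ Set.Ioc a u) {τ} :=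
      Set.disjoint_singleton_right.2 fun h => (not_le.2 huτ) h.2.2
    refine ⟨(hi1.trans hi2).trans hi3, ?_⟩
    rw [← intervalIntegral.integral_add_adjacent_intervals (hi1.trans hi2) hi3,
      ← intervalIntegral.integral_add_adjacent_intervals hi1 hi2, hsplit,
      finsum_mem_union hdisj (hfin' a u) (Set.finite_singleton τ), finsum_mem_singleton]
    linarith

/-! ## §2 The free stretch and the trajectory-level weak equation -/

section Trajectory

open Literature.Analysis.FunctionSpaces

variable {n : ℕ} {ε : ℝ} {γ : ℝ → Config n (Fin 3) T3}

/-- **The `ψ`-weighted pairing on a free stretch.** On `[a, b]` with `(a, b)` collision-free, positions follow the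
free flight (endpoints included), velocities are frozen on `[a, b)` and in the left limit at `b`; the fundamental
theorem of calculus for the free-flight pairings, weighted by the constants `ψ(vᵢ(a))`, gives
`Σᵢ ψ(vᵢ(b⁻)) P(b, xᵢ(b)) − Σᵢ ψ(vᵢ(a)) P(a, xᵢ(a)) = ∫ₐᵇ Σᵢ ψ(vᵢ(s)) Dᵢ(s) ds`, the trajectory integrand agreeing
with the free-flight one off the endpoints. [folklore] -/
theorem ftc_free_left (hγ : IsHardSphereTrajectory (Torus.geometry (Fin 3)) ε n γ)
    {φ : ℝ → T3 → ℝ} (hφ : Torus.IsSmoothSpaceTimeOn Set.univ φ) {h : T3 → ℝ} (hh : Continuous h)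
    (ψ : V3 → ℝ) {a b : ℝ} (hab : a < b)
    (hfree : ∀ τ ∈ Set.Ioo a b, τ ∉ collisionTimes (Torus.geometry (Fin 3)) ε γ) :
    IntervalIntegrable (fun s => ∑ i, ψ (γ s i).2 * ∫ x, (deriv (fun s' => φ s' x) s
        + ∑ k : Fin 3, (γ s i).2 k * Torus.partialDeriv k (φ s) x) * h (x - (γ s i).1)) volume a b ∧
    ∫ s in a..b, ∑ i, ψ (γ s i).2 * ∫ x, (deriv (fun s' => φ s' x) s
        + ∑ k : Fin 3, (γ s i).2 k * Torus.partialDeriv k (φ s) x) * h (x - (γ s i).1) =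
      (∑ i, ψ (Function.leftLim γ b i).2 * ∫ x, φ b x * h (x - (γ b i).1))
        - ∑ i, ψ (γ a i).2 * ∫ x, φ a x * h (x - (γ a i).1) := by
  have hpos : ∀ s ∈ Set.Icc a b, ∀ i, (γ s i).1 = (γ a i).1 + Torus.proj ((s - a) • (γ a i).2) :=
    fun s hs i => ChaosClosesEulerMassBalance.pos_eq_of_free hγ hfree hs i
  have hvel : ∀ s ∈ Set.Ico a b, ∀ i, (γ s i).2 = (γ a i).2 := fun s hs i =>
    ChaosClosesEulerMassBalance.vel_eq_of_free hγ hfree hs i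
  have hlv : ∀ i, (Function.leftLim γ b i).2 = (γ a i).2 := fun i => by
    rw [hγ.leftLim_eq_freeFlight Torus.continuous_geometry_translate hab hfree, freeFlight_apply]
  -- the weighted sum of the free-flight pairings, its derivative, FTC
  have hsum : ∀ s, HasDerivAt
      (fun s' => ∑ i, ψ (γ a i).2 * ∫ x, φ s' x * h (x - ((γ a i).1 + Torus.proj ((s' - a) • (γ a i).2))))
      (∑ i, ψ (γ a i).2 * ∫ x, (deriv (fun s' => φ s' x) s
        + ∑ k : Fin 3, (γ a i).2 k * Torus.partialDeriv k (φ s) x)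
          * h (x - ((γ a i).1 + Torus.proj ((s - a) • (γ a i).2)))) s :=
    fun s => HasDerivAt.fun_sum fun i _ =>
      (ChaosClosesEulerMassBalance.hasDerivAt_integral_freeFlight hφ hh (γ a i).1 (γ a i).2 a s).const_mul
        (ψ (γ a i).2)
  have hsumc : Continuous fun s => ∑ i, ψ (γ a i).2 * ∫ x, (deriv (fun s' => φ s' x) s
      + ∑ k : Fin 3, (γ a i).2 k * Torus.partialDeriv k (φ s) x)
        * h (x - ((γ a i).1 + Torus.proj ((s - a) • (γ a i).2))) :=
    continuous_finsetSum _ fun i _ => continuous_const.mul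
      (ChaosClosesEulerMassBalance.continuous_integral_transportDeriv hφ hh (γ a i).1 (γ a i).2 a)
  have hftc := intervalIntegral.integral_eq_sub_of_hasDerivAt (fun s _ => hsum s) (hsumc.intervalIntegrable a b)
  -- identification with the trajectory functionals off the endpoints
  have hR : Set.EqOn
      (fun s => ∑ i, ψ (γ s i).2 * ∫ x, (deriv (fun s' => φ s' x) s
        + ∑ k : Fin 3, (γ s i).2 k * Torus.partialDeriv k (φ s) x) * h (x - (γ s i).1))
      (fun s => ∑ i, ψ (γ a i).2 * ∫ x, (deriv (fun s' => φ s' x) s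
        + ∑ k : Fin 3, (γ a i).2 k * Torus.partialDeriv k (φ s) x)
          * h (x - ((γ a i).1 + Torus.proj ((s - a) • (γ a i).2)))) (Set.uIoo a b) := by
    intro s hs
    rw [Set.uIoo_of_le hab.le] at hs
    exact Finset.sum_congr rfl fun i _ => by rw [hpos s ⟨hs.1.le, hs.2.le⟩ i, hvel s ⟨hs.1.le, hs.2⟩ i]
  refine ⟨(hsumc.intervalIntegrable a b).congr_uIoo hR.symm, ?_⟩
  rw [intervalIntegral.integral_congr_uIoo hR, hftc]
  congr 1
  · exact Finset.sum_congr rfl fun i _ => by rw [hlv i, hpos b ⟨hab.le, le_rfl⟩ i]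
  · exact Finset.sum_congr rfl fun i _ => by simp

/-- **Bogolyubov's exact weak equation along a hard-sphere trajectory on `𝕋³`** (regular geometry), for a
continuous kernel `h` of the torus difference, a smooth space-time `φ` and an arbitrary velocity weight `ψ`:
`∫φ(t)M_ψ(t) − ∫φ(0)M_ψ(0) = ∫_{[0,t]}∫(∂ₛφ M_ψ + J_ψ·∇φ) + (N+1)⁻¹ Σ_{s ∈ C ∩ (0,t]} Σ_{ordered contact pairs}
(∫φ(s)h(· − xᵢ(s))) (ψ(vᵢ(s)) − ψ(vᵢ(s⁻)))`, where `M_ψ, J_ψ` are the empirical `ψ`-moment field and current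
mollified by `h`. [folklore] -/
theorem weakEquation_of_trajectory {N : ℕ} (hG : (Torus.geometry (Fin 3)).IsHardSphereRegular ε)
    {γ : ℝ → Config (N + 1) (Fin 3) T3} (hγ : IsHardSphereTrajectory (Torus.geometry (Fin 3)) ε (N + 1) γ)
    {hc : T3 → ℝ} (hhc : Continuous hc) {φ : ℝ → T3 → ℝ} (hφ : Torus.IsSmoothSpaceTimeOn Set.univ φ)
    (ψ : V3 → ℝ) {t : ℝ} (ht : 0 ≤ t) :
    (∫ x, φ t x * ∫ q, hc (x - q.1) * ψ q.2 ∂(empiricalMeasure (γ t))) -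
        ∫ x, φ 0 x * ∫ q, hc (x - q.1) * ψ q.2 ∂(empiricalMeasure (γ 0)) =
      (∫ s in Set.Icc 0 t, ∫ x, (deriv (fun s' => φ s' x) s * (∫ q, hc (x - q.1) * ψ q.2 ∂(empiricalMeasure (γ s)))
        + ∑ k : Fin 3, (∫ q, hc (x - q.1) * (q.2 k * ψ q.2) ∂(empiricalMeasure (γ s)))
            * Torus.partialDeriv k (φ s) x))
      + (N + 1 : ℝ)⁻¹ * ∑ᶠ (s : ℝ) (_ : s ∈ collisionTimes (Torus.geometry (Fin 3)) ε γ ∩ Set.Ioc 0 t),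
          ∑ i : Fin (N + 1), ∑ j : Fin (N + 1),
            (if i ≠ j ∧ ‖(Torus.geometry (Fin 3)).sepVec (γ s i).1 (γ s j).1‖ = ε then
              (∫ x, φ s x * hc (x - (γ s i).1)) *
                (ψ (γ s i).2 - ψ (reflectVel ((Torus.geometry (Fin 3)).sepVec (γ s i).1 (γ s j).1)
                  ((γ s i).2, (γ s j).2)).1) else 0) := by
  have hφc : ∀ s, Continuous (φ s) := fun s => (hφ.isSmooth_slice (Set.mem_univ s)).continuous
  -- the pairing, unfolded
  have hL : ∀ s, (∫ x, φ s x * ∫ q, hc (x - q.1) * ψ q.2 ∂(empiricalMeasure (γ s))) =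
      (N + 1 : ℝ)⁻¹ * ∑ i, ψ (γ s i).2 * ∫ x, φ s x * hc (x - (γ s i).1) := by
    intro s
    simp only [integral_empiricalMeasure]
    rw [Nat.cast_add_one]
    have hint : ∀ i, Integrable (fun x => ψ (γ s i).2 * (φ s x * hc (x - (γ s i).1))) := fun i =>
      integrable_of_continuous_T3 (continuous_const.mul ((hφc s).mul (hhc.comp (continuous_id.sub continuous_const))))
    calc ∫ x, φ s x * ((N + 1 : ℝ)⁻¹ * ∑ i, hc (x - (γ s i).1) * ψ (γ s i).2)
        = ∫ x, (N + 1 : ℝ)⁻¹ * ∑ i, ψ (γ s i).2 * (φ s x * hc (x - (γ s i).1)) :=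
          integral_congr_ae (ae_of_all _ fun x => by
            simp only [Finset.mul_sum]
            exact Finset.sum_congr rfl fun i _ => by ring)
      _ = (N + 1 : ℝ)⁻¹ * ∑ i, ∫ x, ψ (γ s i).2 * (φ s x * hc (x - (γ s i).1)) := by
          rw [integral_const_mul, integral_finsetSum _ fun i _ => hint i]
      _ = (N + 1 : ℝ)⁻¹ * ∑ i, ψ (γ s i).2 * ∫ x, φ s x * hc (x - (γ s i).1) := by
          congr 1
          exact Finset.sum_congr rfl fun i _ => integral_const_mul _ _
  -- the transport integrand, unfolded
  have hI : ∀ s, (∫ x, (deriv (fun s' => φ s' x) s * (∫ q, hc (x - q.1) * ψ q.2 ∂(empiricalMeasure (γ s)))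
        + ∑ k : Fin 3, (∫ q, hc (x - q.1) * (q.2 k * ψ q.2) ∂(empiricalMeasure (γ s)))
            * Torus.partialDeriv k (φ s) x)) =
      (N + 1 : ℝ)⁻¹ * ∑ i, ψ (γ s i).2 * ∫ x, (deriv (fun s' => φ s' x) s
        + ∑ k : Fin 3, (γ s i).2 k * Torus.partialDeriv k (φ s) x) * hc (x - (γ s i).1) := by
    intro s
    simp only [integral_empiricalMeasure]
    rw [Nat.cast_add_one]
    have hint : ∀ i, Integrable (fun x => ψ (γ s i).2 * ((deriv (fun s' => φ s' x) s
        + ∑ k : Fin 3, (γ s i).2 k * Torus.partialDeriv k (φ s) x) * hc (x - (γ s i).1))) := fun i =>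
      integrable_of_continuous_T3 (continuous_const.mul
        ((((ChaosClosesEulerMassBalance.continuous_transportDeriv hφ (γ s i).2).comp
          (continuous_const.prodMk continuous_id))).mul (hhc.comp (continuous_id.sub continuous_const))))
    calc ∫ x, (deriv (fun s' => φ s' x) s * ((N + 1 : ℝ)⁻¹ * ∑ i, hc (x - (γ s i).1) * ψ (γ s i).2)
          + ∑ k : Fin 3, ((N + 1 : ℝ)⁻¹ * ∑ i, hc (x - (γ s i).1) * ((γ s i).2 k * ψ (γ s i).2))
            * Torus.partialDeriv k (φ s) x)
        = ∫ x, (N + 1 : ℝ)⁻¹ * ∑ i, ψ (γ s i).2 * ((deriv (fun s' => φ s' x) s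
            + ∑ k : Fin 3, (γ s i).2 k * Torus.partialDeriv k (φ s) x) * hc (x - (γ s i).1)) :=
          integral_congr_ae (ae_of_all _ fun x => by
            simp only [Finset.mul_sum, Finset.sum_mul, add_mul, mul_add, Finset.sum_add_distrib]
            congr 1
            · exact Finset.sum_congr rfl fun i _ => by ring
            · rw [Finset.sum_comm]
              exact Finset.sum_congr rfl fun i _ => Finset.sum_congr rfl fun k _ => by ring)
      _ = (N + 1 : ℝ)⁻¹ * ∑ i, ∫ x, ψ (γ s i).2 * ((deriv (fun s' => φ s' x) s
            + ∑ k : Fin 3, (γ s i).2 k * Torus.partialDeriv k (φ s) x) * hc (x - (γ s i).1)) := by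
          rw [integral_const_mul, integral_finsetSum _ fun i _ => hint i]
      _ = (N + 1 : ℝ)⁻¹ * ∑ i, ψ (γ s i).2 * ∫ x, (deriv (fun s' => φ s' x) s
            + ∑ k : Fin 3, (γ s i).2 k * Torus.partialDeriv k (φ s) x) * hc (x - (γ s i).1) := by
          congr 1
          exact Finset.sum_congr rfl fun i _ => integral_const_mul _ _
  -- the jump term: ordered contact pairs → all particles, value minus left limit
  have hjump : (∑ᶠ (s : ℝ) (_ : s ∈ collisionTimes (Torus.geometry (Fin 3)) ε γ ∩ Set.Ioc 0 t),
      ∑ i : Fin (N + 1), ∑ j : Fin (N + 1),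
        (if i ≠ j ∧ ‖(Torus.geometry (Fin 3)).sepVec (γ s i).1 (γ s j).1‖ = ε then
          (∫ x, φ s x * hc (x - (γ s i).1)) *
            (ψ (γ s i).2 - ψ (reflectVel ((Torus.geometry (Fin 3)).sepVec (γ s i).1 (γ s j).1)
              ((γ s i).2, (γ s j).2)).1) else 0)) =
      ∑ᶠ (s : ℝ) (_ : s ∈ collisionTimes (Torus.geometry (Fin 3)) ε γ ∩ Set.Ioc 0 t),
        ((∑ i, ψ (γ s i).2 * ∫ x, φ s x * hc (x - (γ s i).1))
          - ∑ i, ψ (Function.leftLim γ s i).2 * ∫ x, φ s x * hc (x - (γ s i).1)) := by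
    refine finsum_mem_congr rfl fun s hs => ?_
    rw [ChaosClosesEulerCollisionInvariance.pairSum_eq_particleSum hγ hG hs.1, ← Finset.sum_sub_distrib]
    exact Finset.sum_congr rfl fun i _ => by ring
  -- the glued trajectory identity
  obtain ⟨-, hcore⟩ := glue_pieces (C := collisionTimes (Torus.geometry (Fin 3)) ε γ)
    (fun s => ∑ i, ψ (γ s i).2 * ∫ x, φ s x * hc (x - (γ s i).1))
    (fun s => ∑ i, ψ (Function.leftLim γ s i).2 * ∫ x, φ s x * hc (x - (γ s i).1))
    (fun s => ∑ i, ψ (γ s i).2 * ∫ x, (deriv (fun s' => φ s' x) s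
      + ∑ k : Fin 3, (γ s i).2 k * Torus.partialDeriv k (φ s) x) * hc (x - (γ s i).1))
    hγ.locFinite hγ.exists_Ioo_left_free (fun a b hab hfree => ftc_free_left hγ hφ hhc ψ hab hfree)
    (fun b hb => by simp only [hγ.leftLim_eq_of_not_mem Torus.continuous_geometry_translate hb]) _ ht le_rfl
  beta_reduce at hcore
  rw [hjump, hL t, hL 0, integral_Icc_eq_integral_Ioc, ← intervalIntegral.integral_of_le ht,
    intervalIntegral.integral_congr fun s _ => hI s, intervalIntegral.integral_const_mul]
  linear_combination (N + 1 : ℝ)⁻¹ * hcore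

end Trajectory

/-! ## §3 The registered stub -/

/-- **STUB `stub_weakEquation` (line `Sketch`, crux `ChaosClosesEuler`, stmt-AtomisticToContinuum-15141):
Bogolyubov's exact weak equation for the cone-mollified `ψ`-moments along one good orbit.** For the `r`-cone
`b_r(y, x) = 3/(πr³)(1 − d(y, x)/r)₊`, the mollified `ψ`-moment field `M_ψ(w)(x₀) = ∫ b_r(q.1, x₀) ψ(q.2) dμ_w` and
current `J_ψ`, every smooth space-time `φ` and every `ψ`,
`∫φ(t)M_ψ(γ t) − ∫φ(0)M_ψ(γ 0) = ∫_{[0,t]}∫(∂ₛφ M_ψ + Σₖ (J_ψ)ₖ ∂ₖφ) + (N+1)⁻¹ Σ_{collision times s ∈ (0,t]}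
Σ_{ordered contact pairs (i,j)} (∫φ(s) b_r(xᵢ(s), ·)) (ψ(vᵢ(s)) − ψ(vᵢ⁻))`, `vᵢ⁻ = (reflectVel n (vᵢ, vⱼ)).1` the
pre-collisional velocity (Pulvirenti–Simonella arXiv:1504.03215 §1; from `weakEquation_of_trajectory` with
`Torus.isHardSphereRegular_geometry`, `HardSphereFlow.isTrajectory`). -/
theorem stub_weakEquation :
    ∀ (σ : ℝ), 0 < σ → σ < 2⁻¹ → ∀ (N : ℕ)
    (Φ : HardSphereFlow (Torus.geometry (Fin 3)) (hsDiameter σ N) (N + 1)),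
    ∀ z ∈ Φ.good, ∀ r : ℝ, 0 < r →
    ∀ φ : ℝ → T3 → ℝ, Literature.Analysis.FunctionSpaces.Torus.IsSmoothSpaceTimeOn Set.univ φ →
    ∀ ψ : V3 → ℝ, ∀ t : ℝ, 0 ≤ t →
    let ε := hsDiameter σ N
    let G : Geometry (Fin 3) T3 := Torus.geometry (Fin 3)
    let γ : ℝ → Config (N + 1) (Fin 3) T3 := fun s => Φ.flow s z
    let pv : ℝ → Fin (N + 1) → Fin (N + 1) → V3 × V3 := fun s i j =>
      reflectVel (G.sepVec (γ s i).1 (γ s j).1) ((γ s i).2, (γ s j).2)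
    let bx : T3 → T3 → ℝ := fun y x => 3 / (Real.pi * r ^ 3) * max (1 - Torus.euclidDist y x / r) 0
    let Mψ : Config (N + 1) (Fin 3) T3 → T3 → ℝ := fun w x₀ => ∫ q, bx q.1 x₀ * ψ q.2 ∂(empiricalMeasure w)
    let Jψ : Config (N + 1) (Fin 3) T3 → T3 → Fin 3 → ℝ := fun w x₀ k =>
      ∫ q, bx q.1 x₀ * (q.2 k * ψ q.2) ∂(empiricalMeasure w)
    (∫ x, φ t x * Mψ (γ t) x) - ∫ x, φ 0 x * Mψ (γ 0) x =
      (∫ s in Set.Icc 0 t, ∫ x, (deriv (fun s' => φ s' x) s * Mψ (γ s) x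
        + ∑ k : Fin 3, Jψ (γ s) x k * Literature.Analysis.FunctionSpaces.Torus.partialDeriv k (φ s) x))
      + (N + 1 : ℝ)⁻¹ * ∑ᶠ (s : ℝ) (_ : s ∈ collisionTimes G ε γ ∩ Set.Ioc 0 t),
          ∑ i : Fin (N + 1), ∑ j : Fin (N + 1),
            (if i ≠ j ∧ ‖G.sepVec (γ s i).1 (γ s j).1‖ = ε then
              (∫ x, φ s x * bx (γ s i).1 x) * (ψ (γ s i).2 - ψ (pv s i j).1) else 0) := by
  intro σ hσ hσ2 N Φ z hz r _ φ hφ ψ t ht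
  dsimp only
  -- the cone kernel depends on the torus difference only
  set hc : T3 → ℝ := fun w => 3 / (Real.pi * r ^ 3) * max (1 - ‖Torus.reprSym w‖ / r) 0 with hhc
  have hcont : Continuous hc :=
    continuous_const.mul ((continuous_const.sub (Torus.continuous_norm_reprSym.div_const r)).max continuous_const)
  have hbx : ∀ y x : T3, 3 / (Real.pi * r ^ 3) * max (1 - Torus.euclidDist y x / r) 0 = hc (x - y) := by
    intro y x
    rw [hhc, Torus.euclidDist_comm, Torus.euclidDist_eq]
  simp_rw [hbx]
  exact weakEquation_of_trajectory (Torus.isHardSphereRegular_geometry ((hsDiameter_le hσ.le N).trans_lt hσ2))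
    (Φ.isTrajectory z hz) hcont hφ ψ ht

end Summit.AtomisticToContinuum.HydrodynamicLimit.Theorems.ChaosClosesEulerWeakEquation

end
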